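import Literature.InformationTheory.QuantumCodes.ToricCodeCycles
import Mathlib.Combinatorics.SimpleGraph.Connectivity.Connected
import HarnessLib

/-!
# The Union-Find decoder of Delfosse–Nickerson on the toric code: Algorithm 1 as a growth process

Topic `Literature/InformationTheory/QuantumCodes` (qec cell, LIT-2 lane «MWPM / union-find», LADDER-QEC Q4
"decoder as a FUNCTION with a certified correction radius"). Definitions with bodies + proved API; no named
fact, no sorry.

[DN21] N. Delfosse, N. H. Nickerson, *Almost-linear time decoding algorithm for topological codes*, Quantum 5
(2021) 595, arXiv:1709.06218 — §2 Algorithm 1 ("Union-Find decoder – Naive version"): given the erasure `ε`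
and the syndrome `σ` of a surface code, (1) create the clusters (connected components of the erased edges and
the syndrome vertices), (2) while some cluster contains an ODD number of syndrome vertices, grow every odd
cluster "by half an edge" in all directions, fusing the clusters that meet, (3) return any correction supported
on the grown erasure with the observed syndrome (the peeling decoder [DZ20]). Theorem 1 there: "If
`t + 2s < d`, Algorithm 1 can correct any combination of `t` erased qubits and `s` Z-error" — proved for the
`L × L` toric code in `UnionFindDecoderRadius.lean`; this file fixes the objects.

We formalise the growth on the `L × L` toric lattice of `ToricCodeThreshold.lean` (`Vertex`, `Edge L =
Vertex L × Fin 2`, the link `(v,i)` joining `v` to `v + eᵢ`; `Z`-errors on links, syndrome on sites) at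
HALF-LINK resolution:

* `Half L = Edge L × Bool` — the half of the link `ℓ` at its tail `ℓ.1` (`false`) or at its head `ℓ.1 + eᵢ`
  (`true`); `Half.vert` its site; `slots v` the four halves at the site `v`.
* A growth state is a `Finset (Half L)` of grown halves; `IsFull S ℓ` — both halves grown ("the edge is
  fully covered, the clusters fuse"); `fullGraph S` the graph of full links; `comp S v` the cluster of the
  site `v` (its connected component in `fullGraph S`; a site that is neither a defect nor on a full link is a
  harmless singleton); `charge σ S v ∈ 𝔽₂` the parity of the syndrome inside the cluster of `v`
  ("odd cluster" ⇔ `charge = 1`).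
* `act S h` — the action of a site on its slot `h`: grow its own half if absent, otherwise the far half
  (DN21's support table `0 → 1/2 → 1` per edge); `grow S v` the halves added by the site `v` (all its non-full
  slots); `step σ S` one ROUND: every site of every odd cluster acts (simultaneously); `initial R` the erased
  links fully grown; `state σ R n` the state after `n` rounds; `final σ R` the state after `|Half L| + 1`
  rounds — by `charge_final` no odd cluster is left, i.e. the while-loop has halted (each productive round adds
  a half, `card_lt_card_step`).
* `IsOutput σ R C` — `C` is a valid output of Algorithm 1: a chain supported on the full links of the final
  state ("the grown erasure") with syndrome `σ` (ANY such `C`: every spanning-forest / peeling choice of step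
  (3) is covered); `exists_isOutput` — such a `C` exists for the syndrome of any error chain (even clusters are
  `T`-joinable: pair defects along walks of full links); `ufDecoder R` — the decoder `σ ↦` some output
  (a `ZDecoder` of `ToricCodeThreshold.lean`; noncomputable choice among the valid outputs).

HONEST FRAMING: the toric code only (DN21 state Thm 1 for surface codes with or without boundary); the
almost-linear-time union–find DATA STRUCTURE of DN21 §2 Algorithm 2 (cluster trees, boundary lists) is an
implementation of this growth process and is not modelled — only the mathematical process whose output it
computes; weighted growth (§5) is a different process and is not covered.

## References

* [DelfosseNickerson2021] N. Delfosse, N. H. Nickerson, Quantum 5 (2021) 595, arXiv:1709.06218, §2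
  (Algorithm 1), §3 Thm 1.
* [DelfosseZemor2020] N. Delfosse, G. Zémor, Phys. Rev. Research 2 (2020) 033042, arXiv:1703.01517 (peeling:
  any correction inside a correctable erasure).
* [DennisEtAl2002] E. Dennis, A. Kitaev, A. Landahl, J. Preskill, J. Math. Phys. 43 (2002) 4452, §3.1 (toric
  lattice), §4.3 (success iff `E + E'` is a boundary).
-/

namespace Literature.InformationTheory.QuantumCodes

namespace ToricCode

namespace UnionFind

open Finset Matrix
open Literature.Probability.LatticeModels (TorusSite)

variable {L : ℕ}

/-! ### Half-links -/

variable (L) in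
/-- A **half-link** of the toric lattice: `(ℓ, false)` is the half of the link `ℓ = (v, i)` at its tail `v`,
`(ℓ, true)` the half at its head `v + eᵢ` (DN21: clusters grow "by half an edge").
[cite: DelfosseNickerson2021, §2 Algorithm 1 (step 4: grow by half-edges)] -/
abbrev Half : Type := Edge L × Bool

/-- The tail `v` of the link `(v, i)`. [cite: DennisEtAl2002, §3.1] -/
def tail (ℓ : Edge L) : Vertex L := ℓ.1

/-- The head `v + eᵢ` of the link `(v, i)`. [cite: DennisEtAl2002, §3.1] -/
def head (ℓ : Edge L) : Vertex L := ℓ.1 + dir ℓ.2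

/-- The site at which a half-link sits (tail for `false`, head for `true`). [cite: DelfosseNickerson2021, §2] -/
def Half.vert (h : Half L) : Vertex L := if h.2 then head h.1 else tail h.1

/-- The other half of the same link. [cite: DelfosseNickerson2021, §2] -/
def Half.other (h : Half L) : Half L := (h.1, !h.2)

/-- The other half belongs to the same link. [cite: DelfosseNickerson2021, §2 Algorithm 1 (half-edges)] -/
@[simp] theorem Half.other_fst (h : Half L) : h.other.1 = h.1 := rfl

/-- Taking the other half twice is the identity. [cite: DelfosseNickerson2021, §2 Algorithm 1 (half-edges)] -/
@[simp] theorem Half.other_other (h : Half L) : h.other.other = h := by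
  simp [Half.other]

/-- The two halves of a link are distinct. [cite: DelfosseNickerson2021, §2 Algorithm 1 (half-edges)] -/
theorem Half.other_ne (h : Half L) : h.other ≠ h := by
  rcases h with ⟨ℓ, b⟩
  cases b <;> simp [Half.other]

/-- The four **slots** at a site `v`: the tail halves of the links `(v,0)`, `(v,1)` leaving `v` and the head
halves of the links `(v - e₀, 0)`, `(v - e₁, 1)` arriving at `v`. [cite: DennisEtAl2002, §3.1 (four links at a site)] -/
def slots (v : Vertex L) : Finset (Half L) :=
  {((v, 0), false), ((v, 1), false), ((v - dir 0, 0), true), ((v - dir 1, 1), true)}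

/-- The link `(v - eᵢ, i)` arrives at `v`. [cite: DennisEtAl2002, §3.1 (links of the square lattice)] -/
theorem head_sub_dir (v : Vertex L) (i : Fin 2) : head (v - dir i, i) = v := by
  simp [head]

/-- A half sits at `v` iff it is one of the four slots of `v`. [cite: DennisEtAl2002, §3.1] -/
theorem mem_slots_iff {v : Vertex L} {h : Half L} : h ∈ slots v ↔ h.vert = v := by
  rcases h with ⟨⟨u, i⟩, b⟩
  simp only [slots, Finset.mem_insert, Finset.mem_singleton, Half.vert, head, tail, Prod.mk.injEq]
  constructor
  · rintro (⟨⟨rfl, rfl⟩, rfl⟩ | ⟨⟨rfl, rfl⟩, rfl⟩ | ⟨⟨rfl, rfl⟩, rfl⟩ | ⟨⟨rfl, rfl⟩, rfl⟩) <;> simp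
  · intro hv
    cases b
    · simp only [Bool.false_eq_true, ↓reduceIte] at hv
      subst hv
      fin_cases i <;> simp
    · simp only [↓reduceIte] at hv
      subst hv
      fin_cases i <;> simp

/-! ### Growth states, full links, clusters -/

/-- The link `ℓ` is **full** in the state `S` (both halves grown; DN21: "fully covered edge", the clusters at
its ends are fused). [cite: DelfosseNickerson2021, §2 Algorithm 1 (step 5: fuse clusters meeting on an edge)] -/
def IsFull (S : Finset (Half L)) (ℓ : Edge L) : Prop := (ℓ, false) ∈ S ∧ (ℓ, true) ∈ S

/-- Fullness of a link is decidable. [cite: DelfosseNickerson2021, §2 Algorithm 1 (step 5)] -/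
instance (S : Finset (Half L)) (ℓ : Edge L) : Decidable (IsFull S ℓ) := by
  unfold IsFull; infer_instance

/-- Fullness persists when the state grows. [cite: DelfosseNickerson2021, §2 Algorithm 1 (the support only increases)] -/
theorem IsFull.mono {S S' : Finset (Half L)} (hSS' : S ⊆ S') {ℓ : Edge L} (h : IsFull S ℓ) : IsFull S' ℓ :=
  ⟨hSS' h.1, hSS' h.2⟩

/-- A link is full iff a given half and the other half are both grown. [cite: DelfosseNickerson2021, §2 Algorithm 1 (step 5)] -/
theorem isFull_iff_mem_and_other_mem {S : Finset (Half L)} {h : Half L} :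
    IsFull S h.1 ↔ h ∈ S ∧ h.other ∈ S := by
  rcases h with ⟨ℓ, b⟩
  cases b <;> simp [IsFull, Half.other, and_comm]

/-- The **graph of full links** of a state: sites `u ≠ w` joined by a full link.
[cite: DelfosseNickerson2021, §2 (clusters = connected components of the covered edges)] -/
def fullGraph (S : Finset (Half L)) : SimpleGraph (Vertex L) where
  Adj u w := u ≠ w ∧ ∃ ℓ : Edge L, IsFull S ℓ ∧ ((tail ℓ = u ∧ head ℓ = w) ∨ (tail ℓ = w ∧ head ℓ = u))
  symm := ⟨fun _ _ h => ⟨h.1.symm, h.2.imp fun _ hℓ => ⟨hℓ.1, hℓ.2.symm⟩⟩⟩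
  loopless := ⟨fun _ h => h.1 rfl⟩

/-- More grown halves, more full links. [cite: DelfosseNickerson2021, §2 Algorithm 1 (clusters only grow and fuse)] -/
theorem fullGraph_mono {S S' : Finset (Half L)} (hSS' : S ⊆ S') : fullGraph S ≤ fullGraph S' := by
  rintro u w ⟨hne, ℓ, hℓ, h⟩
  exact ⟨hne, ℓ, hℓ.mono hSS', h⟩

/-- The two (distinct) ends of a full link are adjacent. [cite: DelfosseNickerson2021, §2 Algorithm 1 (step 5: fuse)] -/
theorem fullGraph_adj_of_isFull {S : Finset (Half L)} {ℓ : Edge L} (hℓ : IsFull S ℓ) (hne : tail ℓ ≠ head ℓ) :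
    (fullGraph S).Adj (tail ℓ) (head ℓ) :=
  ⟨hne, ℓ, hℓ, Or.inl ⟨rfl, rfl⟩⟩

/-- The two ends of a full link lie in one cluster. [cite: DelfosseNickerson2021, §2 Algorithm 1 (step 5: fuse)] -/
theorem reachable_tail_head {S : Finset (Half L)} {ℓ : Edge L} (hℓ : IsFull S ℓ) :
    (fullGraph S).Reachable (tail ℓ) (head ℓ) := by
  by_cases hne : tail ℓ = head ℓ
  · rw [hne]
  · exact (fullGraph_adj_of_isFull hℓ hne).reachable

/-- The **action of a site on one of its slots** `h`: grow its own half if it is not yet grown, otherwise grow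
the far half of the same link (DN21's edge support `0 → ½ → 1`). [cite: DelfosseNickerson2021, §2 Algorithm 1 (step 4) and Algorithm 2 (Support table)] -/
def act (S : Finset (Half L)) (h : Half L) : Half L := if h ∈ S then h.other else h

/-- A site acting on a slot grows a half of THAT link. [cite: DelfosseNickerson2021, §2 Algorithm 2 (Support table of the edge)] -/
theorem act_fst (S : Finset (Half L)) (h : Half L) : (act S h).1 = h.1 := by
  unfold act; split_ifs <;> simp

/-- On a non-full link the action of a site grows a NEW half (DN21: the support of the edge strictly
increases). [cite: DelfosseNickerson2021, §2 Algorithm 2 (Support table) and §3 (a new half-edge is covered)] -/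
theorem act_not_mem {S : Finset (Half L)} {h : Half L} (hfull : ¬ IsFull S h.1) : act S h ∉ S := by
  unfold act
  split_ifs with hh
  · intro ho
    exact hfull (isFull_iff_mem_and_other_mem.2 ⟨hh, ho⟩)
  · exact hh

/-- The halves **grown by the site `v`** in one round: its action on each of its non-full slots.
[cite: DelfosseNickerson2021, §2 Algorithm 1 (step 4: grow the cluster by half an edge at every boundary site)] -/
def grow (S : Finset (Half L)) (v : Vertex L) : Finset (Half L) :=
  ((slots v).filter fun h => ¬ IsFull S h.1).image (act S)

/-- **Initialisation**: the erased links are fully grown ("create the list of clusters of the erasure").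
[cite: DelfosseNickerson2021, §2 Algorithm 1 (steps 1–2)] -/
def initial (R : Finset (Edge L)) : Finset (Half L) :=
  R.biUnion fun ℓ => {(ℓ, false), (ℓ, true)}

/-- A half is grown initially iff its link is erased. [cite: DelfosseNickerson2021, §2 Algorithm 1 (steps 1–2)] -/
theorem mem_initial {R : Finset (Edge L)} {h : Half L} : h ∈ initial R ↔ h.1 ∈ R := by
  rcases h with ⟨ℓ, b⟩
  simp only [initial, Finset.mem_biUnion, Finset.mem_insert, Finset.mem_singleton, Prod.mk.injEq]
  constructor
  · rintro ⟨ℓ', hℓ', ⟨rfl, -⟩ | ⟨rfl, -⟩⟩ <;> exact hℓ'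
  · intro hℓ
    cases b
    · exact ⟨ℓ, hℓ, Or.inl ⟨rfl, rfl⟩⟩
    · exact ⟨ℓ, hℓ, Or.inr ⟨rfl, rfl⟩⟩

/-- Initially the full links are exactly the erased links. [cite: DelfosseNickerson2021, §2 Algorithm 1 (steps 1–2)] -/
theorem isFull_initial_iff {R : Finset (Edge L)} {ℓ : Edge L} : IsFull (initial R) ℓ ↔ ℓ ∈ R := by
  simp [IsFull, mem_initial]

variable [NeZero L]

open Classical in
/-- The **cluster** of the site `v` in the state `S`: its connected component in the graph of full links (a
site on no full link is its own singleton cluster). [cite: DelfosseNickerson2021, §2 Algorithm 1 (step 1: clusters)] -/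
noncomputable def comp (S : Finset (Half L)) (v : Vertex L) : Finset (Vertex L) :=
  univ.filter fun w => (fullGraph S).Reachable v w

/-- Membership in a cluster is reachability along full links. [cite: DelfosseNickerson2021, §2 Algorithm 1 (step 1: clusters)] -/
theorem mem_comp {S : Finset (Half L)} {v w : Vertex L} : w ∈ comp S v ↔ (fullGraph S).Reachable v w := by
  classical
  simp [comp]

/-- Every site lies in its own cluster. [cite: DelfosseNickerson2021, §2 Algorithm 1 (step 1: clusters)] -/
theorem mem_comp_self (S : Finset (Half L)) (v : Vertex L) : v ∈ comp S v :=
  mem_comp.2 SimpleGraph.Reachable.rfl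

/-- Clusters are equivalence classes: a site of the cluster of `v` has the same cluster. [cite: DelfosseNickerson2021, §2 Algorithm 1 (step 1: clusters)] -/
theorem comp_eq_comp_of_mem {S : Finset (Half L)} {v w : Vertex L} (h : w ∈ comp S v) : comp S w = comp S v := by
  ext x
  rw [mem_comp, mem_comp]
  have hvw := mem_comp.1 h
  exact ⟨fun hx => hvw.trans hx, fun hx => hvw.symm.trans hx⟩

/-- Clusters only grow when the state grows. [cite: DelfosseNickerson2021, §2 Algorithm 1 (clusters grow and fuse)] -/
theorem comp_mono {S S' : Finset (Half L)} (hSS' : S ⊆ S') (v : Vertex L) : comp S v ⊆ comp S' v := fun _ hw =>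
  mem_comp.2 ((mem_comp.1 hw).mono (fullGraph_mono hSS'))

/-- The two ends of a full link lie in the same clusters. [cite: DelfosseNickerson2021, §2 Algorithm 1 (step 5: fuse)] -/
theorem tail_mem_comp_iff_head_mem_comp {S : Finset (Half L)} {ℓ : Edge L} (hℓ : IsFull S ℓ) (v : Vertex L) :
    tail ℓ ∈ comp S v ↔ head ℓ ∈ comp S v := by
  rw [mem_comp, mem_comp]
  exact ⟨fun h => h.trans (reachable_tail_head hℓ), fun h => h.trans (reachable_tail_head hℓ).symm⟩

/-- The **defects**: sites with non-zero syndrome. [cite: DennisEtAl2002, §4.2 (sites with X_s = -1)] -/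
noncomputable def defects (σ : Syndrome L) : Finset (Vertex L) :=
  univ.filter fun v => σ v ≠ 0

/-- Membership in the defect set. [cite: DennisEtAl2002, §4.2 (sites with X_s = -1)] -/
theorem mem_defects {σ : Syndrome L} {v : Vertex L} : v ∈ defects σ ↔ σ v ≠ 0 := by
  simp [defects]

/-- The **charge** of the cluster of `v`: the syndrome summed over the cluster, in `𝔽₂` — `1` iff the cluster
contains an odd number of defects ("odd cluster"). [cite: DelfosseNickerson2021, §2 Algorithm 1 (step 3: clusters with an odd number of syndrome vertices)] -/
noncomputable def charge (σ : Syndrome L) (S : Finset (Half L)) (v : Vertex L) : ZMod 2 :=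
  ∑ w ∈ comp S v, σ w

/-- The charge is a function of the cluster. [cite: DelfosseNickerson2021, §2 Algorithm 1 (step 3: parity of a cluster)] -/
theorem charge_eq_of_mem_comp {σ : Syndrome L} {S : Finset (Half L)} {v w : Vertex L} (h : w ∈ comp S v) :
    charge σ S w = charge σ S v := by
  rw [charge, charge, comp_eq_comp_of_mem h]

/-! ### One round of Algorithm 1 -/

open Classical in
/-- **One round** of Algorithm 1: every site of every odd cluster acts on all its non-full slots,
simultaneously. [cite: DelfosseNickerson2021, §2 Algorithm 1 (steps 3–5: grow all odd clusters by half an edge, fuse)] -/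
noncomputable def step (σ : Syndrome L) (S : Finset (Half L)) : Finset (Half L) :=
  S ∪ (univ.filter fun v => charge σ S v = 1).biUnion (grow S)

/-- A round only adds halves. [cite: DelfosseNickerson2021, §2 Algorithm 1 (the support only increases)] -/
theorem subset_step (σ : Syndrome L) (S : Finset (Half L)) : S ⊆ step σ S :=
  Finset.subset_union_left

/-- A half is grown after a round iff it was grown before or some site of an odd cluster grew it.
[cite: DelfosseNickerson2021, §2 Algorithm 1 (steps 3–4)] -/
theorem mem_step {σ : Syndrome L} {S : Finset (Half L)} {h : Half L} :
    h ∈ step σ S ↔ h ∈ S ∨ ∃ v, charge σ S v = 1 ∧ h ∈ grow S v := by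
  classical
  simp [step]

/-- The state after `n` rounds. [cite: DelfosseNickerson2021, §2 Algorithm 1 (while loop)] -/
noncomputable def state (σ : Syndrome L) (R : Finset (Edge L)) (n : ℕ) : Finset (Half L) :=
  (step σ)^[n] (initial R)

/-- Before the first round the state is the initial one. [cite: DelfosseNickerson2021, §2 Algorithm 1 (steps 1–2)] -/
theorem state_zero (σ : Syndrome L) (R : Finset (Edge L)) : state σ R 0 = initial R := rfl

/-- The state after `n + 1` rounds is one round applied to the state after `n`. [cite: DelfosseNickerson2021, §2 Algorithm 1 (while loop)] -/
theorem state_succ (σ : Syndrome L) (R : Finset (Edge L)) (n : ℕ) : state σ R (n + 1) = step σ (state σ R n) := by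
  rw [state, Function.iterate_succ_apply']
  rfl

/-- States grow along the rounds. [cite: DelfosseNickerson2021, §2 Algorithm 1 (the support only increases)] -/
theorem state_mono (σ : Syndrome L) (R : Finset (Edge L)) {m n : ℕ} (h : m ≤ n) : state σ R m ⊆ state σ R n := by
  induction n, h using Nat.le_induction with
  | base => exact Finset.Subset.refl _
  | succ n _ ih => rw [state_succ]; exact ih.trans (subset_step σ _)

/-- The erased halves stay grown. [cite: DelfosseNickerson2021, §2 Algorithm 1 (steps 1–2)] -/
theorem initial_subset_state (σ : Syndrome L) (R : Finset (Edge L)) (n : ℕ) : initial R ⊆ state σ R n := by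
  rw [← state_zero σ R]; exact state_mono σ R (Nat.zero_le n)

variable (L) in
/-- The number of rounds after which the process is frozen: one more than the number of half-links.
[cite: DelfosseNickerson2021, §2 (the growth terminates)] -/
noncomputable def horizon : ℕ := Fintype.card (Half L) + 1

/-- The **final state** of Algorithm 1 (the grown erasure, at half-link resolution).
[cite: DelfosseNickerson2021, §2 Algorithm 1 (exit of the while loop)] -/
noncomputable def final (σ : Syndrome L) (R : Finset (Edge L)) : Finset (Half L) :=
  state σ R (horizon L)

/-- **`C` is a valid output of Algorithm 1** on the syndrome `σ` and erasure `R`: a chain supported on the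
full links of the final state ("apply the peeling decoder to the grown erasure") with syndrome `σ`. Every
peeling / spanning-forest choice of DN21 step (3) [DZ20] yields such a `C`.
[cite: DelfosseNickerson2021, §2 Algorithm 1 (final step)] [cite: DelfosseZemor2020, §2 (any error inside the erasure with the right syndrome)] -/
def IsOutput (σ : Syndrome L) (R : Finset (Edge L)) (C : Chain L) : Prop :=
  (∀ ℓ, C ℓ ≠ 0 → IsFull (final σ R) ℓ) ∧ syn L C = σ

/-! ### Termination: the final state has no odd cluster -/

section Termination

/-- The syndrome of a single link is supported on its two ends: `∂(1_ℓ) = 1_{tail ℓ} + 1_{head ℓ}`.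
[cite: DennisEtAl2002, §4.3 (the boundary of a chain)] -/
theorem syn_single (ℓ : Edge L) (s : Vertex L) :
    syn L (Pi.single ℓ 1) s = (if s = tail ℓ then 1 else 0) + (if s = head ℓ then 1 else 0) := by
  rcases ℓ with ⟨u, i⟩
  unfold syn
  rw [starMatrix_mulVec_apply]
  simp only [Pi.single_apply, Prod.mk.injEq, tail, head]
  have hsd : ∀ j : Fin 2, (s - dir j = u ∧ j = i) ↔ (s = u + dir i ∧ j = i) := by
    intro j
    constructor
    · rintro ⟨h, rfl⟩; exact ⟨by rw [← h, sub_add_cancel], rfl⟩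
    · rintro ⟨h, rfl⟩; exact ⟨by rw [h, add_sub_cancel_right], rfl⟩
  simp only [hsd]
  fin_cases i
  · simp only [Fin.zero_eta, Fin.isValue, and_true, one_ne_zero, and_false, ↓reduceIte, add_zero]
    by_cases h1 : s = u <;> by_cases h2 : s = u + dir 0 <;> simp [h1, h2]
  · simp only [Fin.mk_one, Fin.isValue, zero_ne_one, and_false, ↓reduceIte, and_true, zero_add]
    by_cases h1 : s = u <;> by_cases h2 : s = u + dir 1 <;> simp [h1, h2]

/-- The total syndrome of any chain vanishes (every link has two ends): `Σ_s (∂e)_s = 0`.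
[cite: DennisEtAl2002, §4.2 (defects come in pairs)] -/
theorem sum_syn_eq_zero (e : Chain L) : ∑ s, syn L e s = 0 := by
  classical
  -- expand `e` in the basis of single links
  have he : e = ∑ ℓ, e ℓ • (Pi.single ℓ (1 : ZMod 2) : Chain L) := by
    funext ℓ'
    simp [Finset.sum_apply, Pi.single_apply]
  have hlin : ∀ s, syn L e s = ∑ ℓ, e ℓ * syn L (Pi.single ℓ 1) s := by
    intro s
    conv_lhs => rw [he]
    unfold syn
    rw [Matrix.mulVec_sum]
    simp only [Finset.sum_apply, Matrix.mulVec_smul, Pi.smul_apply, smul_eq_mul]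
  simp_rw [hlin]
  rw [Finset.sum_comm]
  refine Finset.sum_eq_zero fun ℓ _ => ?_
  rw [← Finset.mul_sum]
  have h2 : ∑ s, syn L (Pi.single ℓ 1) s = 0 := by
    simp_rw [syn_single]
    rw [Finset.sum_add_distrib, Finset.sum_ite_eq' univ (tail ℓ), Finset.sum_ite_eq' univ (head ℓ)]
    simp only [Finset.mem_univ, ↓reduceIte]
    decide
  rw [h2, mul_zero]

/-- Every site of the torus is reachable from every other along lattice links (the lattice is connected), so
a set of sites closed under lattice neighbours is everything. [cite: DennisEtAl2002, §3.1 (the L × L torus)] -/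
theorem eq_univ_of_closed {K : Finset (Vertex L)} (hne : K.Nonempty)
    (hcl : ∀ v ∈ K, ∀ i : Fin 2, v + dir i ∈ K) : K = univ := by
  -- closure under `+ eᵢ` iterated gives closure under adding any multiple of `eᵢ`
  have hclosed : ∀ v ∈ K, ∀ (i : Fin 2) (n : ℕ), v + n • dir i ∈ K := by
    intro v hv i n
    induction n with
    | zero => simpa using hv
    | succ n ih =>
      have h := hcl _ ih i
      rwa [add_assoc, ← succ_nsmul] at h
  obtain ⟨v₀, hv₀⟩ := hne
  refine Finset.eq_univ_of_forall fun w => ?_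
  set a : ZMod L := (w - v₀) 0 with ha
  set b : ZMod L := (w - v₀) 1 with hb
  have h := hclosed _ (hclosed v₀ hv₀ 0 a.val) 1 b.val
  have hw : v₀ + a.val • (dir 0 : Vertex L) + b.val • dir 1 = w := by
    funext j
    simp only [Pi.add_apply, Pi.smul_apply]
    simp only [nsmul_eq_mul, ZMod.natCast_zmod_val, dir, Pi.single_apply]
    fin_cases j
    · simp [ha]
    · simp [hb]
  rwa [hw] at h

/-- Every element of `𝔽₂` is `0` or `1`. [folklore] -/
private theorem z2_eq_zero_or_one : ∀ x : ZMod 2, x = 0 ∨ x = 1 := by decide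

/-- If no cluster is odd, a round changes nothing. [cite: DelfosseNickerson2021, §2 Algorithm 1 (while condition)] -/
theorem step_eq_self_of_forall {σ : Syndrome L} {S : Finset (Half L)} (h : ∀ v, charge σ S v ≠ 1) :
    step σ S = S := by
  classical
  unfold step
  rw [Finset.filter_false_of_mem fun v _ => h v, Finset.biUnion_empty, Finset.union_empty]

/-- **An odd cluster has a site with a non-full slot** (otherwise it would be closed under lattice
neighbours, hence everything, hence of even total charge). Needs `Σ_s σ_s = 0`.
[cite: DelfosseNickerson2021, §3 proof of Thm 1 ("a cluster grows … when there are an odd number of syndrome vertices")] -/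
theorem exists_slot_not_isFull {σ : Syndrome L} (hσ : ∑ s, σ s = 0) {S : Finset (Half L)} {v : Vertex L}
    (hodd : charge σ S v = 1) : ∃ u ∈ comp S v, ∃ h ∈ slots u, ¬ IsFull S h.1 := by
  by_contra hcon
  push Not at hcon
  have hcl : ∀ u ∈ comp S v, ∀ i : Fin 2, u + dir i ∈ comp S v := by
    intro u hu i
    have hfull : IsFull S (u, i) := hcon u hu ((u, i), false) (by fin_cases i <;> simp [slots])
    have hr : (fullGraph S).Reachable u (u + dir i) := reachable_tail_head hfull
    exact mem_comp.2 ((mem_comp.1 hu).trans hr)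
  have huniv : comp S v = univ := eq_univ_of_closed ⟨v, mem_comp_self S v⟩ hcl
  rw [charge, huniv, hσ] at hodd
  exact zero_ne_one hodd

/-- **A productive round adds a half**: if some cluster is odd then the state strictly grows.
[cite: DelfosseNickerson2021, §3 proof of Thm 1 ("when a cluster grows, at least one new half-edge … is covered")] -/
theorem card_lt_card_step {σ : Syndrome L} (hσ : ∑ s, σ s = 0) {S : Finset (Half L)} {v : Vertex L}
    (hodd : charge σ S v = 1) : S.card < (step σ S).card := by
  classical
  obtain ⟨u, hu, h, hh, hfull⟩ := exists_slot_not_isFull hσ hodd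
  refine Finset.card_lt_card ⟨subset_step σ S, fun hsub => act_not_mem hfull (hsub ?_)⟩
  rw [mem_step]
  refine Or.inr ⟨u, ?_, ?_⟩
  · rw [charge_eq_of_mem_comp hu, hodd]
  · exact Finset.mem_image.2 ⟨h, Finset.mem_filter.2 ⟨hh, hfull⟩, rfl⟩

/-- Once frozen, the state never changes again. [cite: DelfosseNickerson2021, §2 Algorithm 1 (exit of the while loop)] -/
theorem state_eq_of_step_eq {σ : Syndrome L} {R : Finset (Edge L)} {n : ℕ}
    (h : step σ (state σ R n) = state σ R n) {m : ℕ} (hm : n ≤ m) : state σ R m = state σ R n := by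
  induction m, hm using Nat.le_induction with
  | base => rfl
  | succ m _ ih => rw [state_succ, ih, h]

/-- **Termination**: in the final state no cluster is odd (the while loop of Algorithm 1 has halted after at
most `|Half L|` productive rounds). Needs `Σ_s σ_s = 0` (true for every syndrome `∂e`, `sum_syn_eq_zero`).
[cite: DelfosseNickerson2021, §2 Algorithm 1 (the loop halts: no odd cluster left)] -/
theorem charge_final {σ : Syndrome L} (hσ : ∑ s, σ s = 0) (R : Finset (Edge L)) (v : Vertex L) :
    charge σ (final σ R) v = 0 := by
  classical
  -- either some round `n ≤ |Half L|` is unproductive (then the state is frozen from there on), or every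
  -- round up to `|Half L| + 1` adds a half — impossible.
  by_cases hex : ∃ n, n ≤ Fintype.card (Half L) ∧ ∀ w, charge σ (state σ R n) w ≠ 1
  · obtain ⟨n, hn, hfrozen⟩ := hex
    have hstep : step σ (state σ R n) = state σ R n := step_eq_self_of_forall hfrozen
    have hfin : final σ R = state σ R n := state_eq_of_step_eq hstep (by unfold horizon; omega)
    rw [hfin]
    have h := hfrozen v
    -- in `𝔽₂`, not `1` means `0`
    rcases z2_eq_zero_or_one (charge σ (state σ R n) v) with h0 | h1
    · exact h0
    · exact absurd h1 h
  · push Not at hex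
    have hgrow : ∀ n, n ≤ Fintype.card (Half L) → n + (initial R).card ≤ (state σ R n).card := by
      intro n hn
      induction n with
      | zero => simp [state_zero]
      | succ n ih =>
        obtain ⟨w, hw⟩ := hex n (by omega)
        have hlt := card_lt_card_step hσ hw
        rw [← state_succ] at hlt
        have := ih (by omega)
        omega
    have hle : (state σ R (Fintype.card (Half L))).card ≤ Fintype.card (Half L) := Finset.card_le_univ _
    obtain ⟨w, hw⟩ := hex (Fintype.card (Half L)) le_rfl
    have hlt := card_lt_card_step hσ hw
    have hle' : (step σ (state σ R (Fintype.card (Half L)))).card ≤ Fintype.card (Half L) :=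
      Finset.card_le_univ _
    have := hgrow (Fintype.card (Half L)) le_rfl
    omega

end Termination

/-! ### Valid outputs exist: even clusters are `T`-joins of full links -/

section Output

/-- The chain of a walk in the graph of full links: one full link per step (a chosen one joining the two
sites of the step). [cite: DelfosseZemor2020, §2 (a path of erased edges joining two syndrome vertices)] -/
noncomputable def walkChain {S : Finset (Half L)} : {a b : Vertex L} → (fullGraph S).Walk a b → Chain L
  | _, _, SimpleGraph.Walk.nil => 0
  | _, _, SimpleGraph.Walk.cons h p => Pi.single (Classical.choose h.2) 1 + walkChain p

omit [NeZero L] in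
/-- The chain of a walk is supported on full links. [cite: DelfosseZemor2020, §2] -/
theorem isFull_of_walkChain_ne_zero {S : Finset (Half L)} {a b : Vertex L} (p : (fullGraph S).Walk a b)
    {ℓ : Edge L} (hℓ : walkChain p ℓ ≠ 0) : IsFull S ℓ := by
  induction p with
  | nil => simp [walkChain] at hℓ
  | cons h p ih =>
    rw [walkChain, Pi.add_apply] at hℓ
    by_cases h1 : (Pi.single (Classical.choose h.2) (1 : ZMod 2) : Chain L) ℓ = 0
    · rw [h1, zero_add] at hℓ
      exact ih hℓ
    · rw [Pi.single_apply] at h1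
      split_ifs at h1 with heq
      · rw [heq]; exact (Classical.choose_spec h.2).1
      · exact absurd rfl h1

/-- The syndrome of the chain of a walk from `a` to `b` is `1_a + 1_b` (interior sites are met twice).
[cite: DennisEtAl2002, §4.3 (an open chain has its boundary at its two ends)] -/
theorem syn_walkChain {S : Finset (Half L)} {a b : Vertex L} (p : (fullGraph S).Walk a b) :
    syn L (walkChain p) = Pi.single a 1 + Pi.single b 1 := by
  induction p with
  | nil =>
    rw [walkChain]
    funext s
    unfold syn
    simp only [Matrix.mulVec_zero, Pi.zero_apply, Pi.add_apply, Pi.single_apply]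
    split_ifs <;> decide
  | cons h p ih =>
    rename_i u w c
    rw [walkChain]
    have hlin : syn L (Pi.single (Classical.choose h.2) 1 + walkChain p) =
        syn L (Pi.single (Classical.choose h.2) 1) + syn L (walkChain p) := by
      unfold syn; rw [Matrix.mulVec_add]
    rw [hlin, ih]
    funext s
    simp only [Pi.add_apply, syn_single, Pi.single_apply]
    obtain ⟨hne, hends⟩ := (Classical.choose_spec h.2)
    have key : ((if s = tail (Classical.choose h.2) then (1 : ZMod 2) else 0) +
        if s = head (Classical.choose h.2) then 1 else 0) =
        (if s = u then 1 else 0) + if s = w then 1 else 0 := by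
      rcases hends with ⟨ht, hh⟩ | ⟨ht, hh⟩ <;> rw [ht, hh]
      rw [add_comm]
    rw [key]
    have h2 : ∀ x : ZMod 2, x + x = 0 := by decide
    by_cases hsu : s = u <;> by_cases hsw : s = w <;> by_cases hsc : s = c <;>
      simp [hsu, hsw, hsc, h2] <;> simp_all
    
/-- **Even clusters can be discharged inside the full links**: if every cluster of the state `S` carries
charge `0` for `σ`, then some chain supported on the full links of `S` has syndrome `σ` (pair up the defects
of each cluster along walks of full links — the `T`-join / peeling step).
[cite: DelfosseZemor2020, §2 (Lemma 1: any error inside the erasure with the measured syndrome)] -/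
theorem exists_chain_of_charge_eq_zero (S : Finset (Half L)) :
    ∀ σ : Syndrome L, (∀ v, charge σ S v = 0) →
      ∃ C : Chain L, (∀ ℓ, C ℓ ≠ 0 → IsFull S ℓ) ∧ syn L C = σ := by
  classical
  -- induction on the number of defects
  suffices h : ∀ (n : ℕ) (σ : Syndrome L), (defects σ).card ≤ n → (∀ v, charge σ S v = 0) →
      ∃ C : Chain L, (∀ ℓ, C ℓ ≠ 0 → IsFull S ℓ) ∧ syn L C = σ from
    fun σ hσ => h _ σ le_rfl hσ
  intro n
  induction n with
  | zero =>
    intro σ hcard _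
    have hσ0 : σ = 0 := by
      funext v
      by_contra hv
      have : v ∈ defects σ := mem_defects.2 hv
      rw [Finset.card_eq_zero.1 (Nat.le_zero.1 hcard)] at this
      simp at this
    refine ⟨0, fun ℓ hℓ => absurd rfl hℓ, ?_⟩
    rw [hσ0]; unfold syn; exact Matrix.mulVec_zero _
  | succ n ih =>
    intro σ hcard hch
    by_cases hempty : defects σ = ∅
    · exact ih σ (by rw [hempty]; simp) hch
    obtain ⟨a, ha⟩ := Finset.nonempty_iff_ne_empty.2 hempty
    have hσa : σ a = 1 := by
      rcases z2_eq_zero_or_one (σ a) with h0 | h1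
      · exact absurd h0 (mem_defects.1 ha)
      · exact h1
    -- a second defect in the cluster of `a`
    have hb : ∃ b ∈ comp S a, b ≠ a ∧ σ b ≠ 0 := by
      by_contra hcon
      push Not at hcon
      have hsum : charge σ S a = σ a := by
        rw [charge, ← Finset.add_sum_erase _ _ (mem_comp_self S a)]
        rw [Finset.sum_eq_zero fun w hw => ?_, add_zero]
        rw [Finset.mem_erase] at hw
        exact hcon w hw.2 hw.1
      rw [hch a, hσa] at hsum
      exact zero_ne_one hsum
    obtain ⟨b, hbcomp, hba, hσb⟩ := hb
    obtain ⟨p⟩ := (mem_comp.1 hbcomp)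
    -- remove the pair `{a, b}`
    set σ' : Syndrome L := σ + Pi.single a 1 + Pi.single b 1 with hσ'
    have h2 : ∀ x : ZMod 2, x + x = 0 := by decide
    have hσ'a : σ' a = 0 := by simp [hσ', hσa, hba.symm, h2]
    have hσb1 : σ b = 1 := by
      rcases z2_eq_zero_or_one (σ b) with h0 | h1
      · exact absurd h0 hσb
      · exact h1
    have hσ'b : σ' b = 0 := by simp [hσ', hσb1, hba, h2]
    have hσ'x : ∀ x, x ≠ a → x ≠ b → σ' x = σ x := by
      intro x hxa hxb; simp [hσ', hxa, hxb]
    have hdef : defects σ' ⊆ (defects σ).erase a := by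
      intro x hx
      rw [mem_defects] at hx
      rw [Finset.mem_erase, mem_defects]
      have hxa : x ≠ a := fun h => hx (h ▸ hσ'a)
      have hxb : x ≠ b := fun h => hx (h ▸ hσ'b)
      exact ⟨hxa, by rwa [hσ'x x hxa hxb] at hx⟩
    have hcard' : (defects σ').card ≤ n := by
      have := Finset.card_le_card hdef
      rw [Finset.card_erase_of_mem ha] at this
      omega
    have hch' : ∀ v, charge σ' S v = 0 := by
      intro v
      have hab : a ∈ comp S v ↔ b ∈ comp S v := by
        constructor
        · intro hav
          rw [← comp_eq_comp_of_mem hav]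
          exact hbcomp
        · intro hbv
          have ha' : a ∈ comp S b := by rw [comp_eq_comp_of_mem hbcomp]; exact mem_comp_self S a
          rw [← comp_eq_comp_of_mem hbv]
          exact ha'
      rw [charge, hσ']
      simp only [Pi.add_apply, Finset.sum_add_distrib]
      rw [show ∑ w ∈ comp S v, σ w = 0 from hch v, zero_add]
      rw [Finset.sum_pi_single' a (1 : ZMod 2), Finset.sum_pi_single' b (1 : ZMod 2)]
      by_cases hav : a ∈ comp S v
      · simp [hav, hab.1 hav, h2]
      · simp [hav, mt hab.2 hav]
    obtain ⟨C', hC'supp, hC'syn⟩ := ih σ' hcard' hch'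
    refine ⟨C' + walkChain p, fun ℓ hℓ => ?_, ?_⟩
    · rw [Pi.add_apply] at hℓ
      by_cases h1 : C' ℓ = 0
      · rw [h1, zero_add] at hℓ; exact isFull_of_walkChain_ne_zero p hℓ
      · exact hC'supp ℓ h1
    · have hlin : syn L (C' + walkChain p) = syn L C' + syn L (walkChain p) := by
        unfold syn; rw [Matrix.mulVec_add]
      rw [hlin, hC'syn, syn_walkChain, hσ']
      funext s
      simp only [Pi.add_apply]
      -- `σ + 1_a + 1_b + (1_a + 1_b) = σ` in characteristic 2
      have h2' : ∀ x y z : ZMod 2, x + y + z + (y + z) = x := by decide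
      exact h2' _ _ _

/-- **A valid output exists** for the syndrome of any error chain: Algorithm 1 is well defined (its last step
finds a correction inside the grown erasure). [cite: DelfosseNickerson2021, §2 Algorithm 1 (final step: peeling inside the grown erasure)] -/
theorem exists_isOutput (e : Chain L) (R : Finset (Edge L)) : ∃ C : Chain L, IsOutput (syn L e) R C :=
  exists_chain_of_charge_eq_zero (final (syn L e) R) (syn L e) (charge_final (sum_syn_eq_zero e) R)

/-- **The Union-Find decoder** of the `L × L` toric code with erasure `R` (DN21 Algorithm 1): syndrome `σ ↦`
a valid output (a correction supported on the grown erasure with syndrome `σ`; some fixed choice among them —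
every such choice is covered by the radius theorem), and `0` on non-syndromes.
[cite: DelfosseNickerson2021, §2 Algorithm 1] -/
noncomputable def ufDecoder (R : Finset (Edge L)) : ZDecoder L := fun σ =>
  open Classical in if h : ∃ C : Chain L, IsOutput σ R C then h.choose else 0

/-- The Union-Find decoder returns a valid output of Algorithm 1 on every syndrome.
[cite: DelfosseNickerson2021, §2 Algorithm 1] -/
theorem isOutput_ufDecoder (R : Finset (Edge L)) (e : Chain L) : IsOutput (syn L e) R (ufDecoder R (syn L e)) := by
  unfold ufDecoder
  rw [dif_pos (exists_isOutput e R)]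
  exact (exists_isOutput e R).choose_spec

/-- Erased links are full in the final state (they are full from the start and states only grow).
[cite: DelfosseNickerson2021, §2 Algorithm 1 (steps 1–2)] -/
theorem isFull_final_of_mem {σ : Syndrome L} {R : Finset (Edge L)} {ℓ : Edge L} (hℓ : ℓ ∈ R) :
    IsFull (final σ R) ℓ :=
  (isFull_initial_iff.2 hℓ).mono (initial_subset_state σ R _)

/-- For a valid output `C` on the syndrome of `e`, the net chain `e + C` is a cycle (`∂(e + C) = 2∂e = 0`).
[cite: DennisEtAl2002, §4.3 (E + E' is a cycle)] -/
theorem IsOutput.add_mem_cycles {e C : Chain L} {R : Finset (Edge L)} (hC : IsOutput (syn L e) R C) :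
    e + C ∈ cycles L := by
  change syn L (e + C) = 0
  have hlin : syn L (e + C) = syn L e + syn L C := by unfold syn; rw [Matrix.mulVec_add]
  rw [hlin, hC.2]
  funext s
  have h2 : ∀ x : ZMod 2, x + x = 0 := by decide
  exact h2 _

/-- **The Union-Find decoder corrects `e` iff its output closes `e` to a boundary** (DKLP success
criterion, `Decoder.Corrects`). [cite: DennisEtAl2002, §4.3 (success iff E + E' is homologically trivial)] -/
theorem ufDecoder_corrects_iff (R : Finset (Edge L)) (e : Chain L) :
    (ufDecoder R).Corrects (syn L) (boundaries L) e ↔ ufDecoder R (syn L e) + e ∈ boundaries L := Iff.rfl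

end Output



end UnionFind

end ToricCode

end Literature.InformationTheory.QuantumCodes
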